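import Summits.NavierStokesRegularity.NavierStokesRegularity.Theorems.PalasekTowerBreakdownEpisodeBaseSlice
import Summits.NavierStokesRegularity.FluidComputer.PalasekTowerBurgersLayerRobust

/-!
# NavierStokesRegularity — route `PalasekTowerBreakdown`, crux `EpisodeBase`: the Burgers-LAYER read-out door
# (the level-`1` letter of the explicit stub from CLOSENESS of the terminal slice to a translated layer)

Supports `stmt-NavierStokesRegularity-19179` (`PalasekTowerBreakdown.EpisodeBase` = K1G `EpisodeBaseG`; helper, closes
nothing). Cell `ns-blowup`, seat `ns-blowup-ecbridge-4` (g6; stub `first_episode`, line `slot` v5: registered stub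
`stub_explicit_slice_run : ExplicitSliceRun` = an explicit germ design `d : Germ.LineGermData U ρ σ₀ ε c₄` + ONE classical
finite-energy run `(v, q)` on `[1, Host.τfirst]` from `U` under `lineForce U σ₀ ε`, below `(5/3)Y₁`, showing at
`Host.τfirst` in `B̄(0, ρ)` the three level-`1` readouts; door `…_episodeBase_of_lineGerm_sliceRun`, p470149). The crux
idea «orthogonal-seed-contact-strain» (19179 evidence #47/#48; holder READ #64: adopted with one repair) reads the grown
level as a Burgers vortex LAYER; `FluidComputer/PalasekTowerBurgersLayerReadoutFloors` (p479822) proves its first lemma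
`OrthogonalSeed.layerReadoutWide` and `FluidComputer/PalasekTowerBurgersLayerRobust` (p481328) makes the read-out ROBUST:
a slice within `261` of the layer `OrthogonalSeed.readout = burgersLayer 260000 1 6400` at `c + x⋆` (`x⋆ = (1/120,0,0)`),
within `61000` in derivative at `c`, and within `500` along the loop `c + γ_{1/N₁}` satisfies the three pointed level-`1`
readouts. This file states the consequence BY NAME for the route:

* `palasekTowerBreakdown_sliceReadouts_of_near_layer` — for ANY continuous slice `w` and centre `c` with
  `‖c‖ + 1/120 ≤ ρ`, the three closeness hypotheses give the read-out conjuncts of the explicit letter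
  (`∃ x, ‖x‖ ≤ ρ ∧ Y₁ ≤ ‖w x‖`, `∃ x, ‖x‖ ≤ ρ ∧ A₁ ≤ ‖Dw(x)‖`, the `N₁`-core loop clause) verbatim;
* `palasekTowerBreakdown_episodeBase_of_lineGerm_run_near_layer` — **`EpisodeBase` from an explicit design, ONE
  classical finite-energy window run from `U` under the design's own force below `(5/3)Y₁`, and CLOSENESS of its terminal
  slice `v Host.τfirst` to a translated Burgers layer at three places** (the profile-and-certify form of the stub: a
  certificate delivers sup-closeness to a named profile, not the register's clauses one by one).

LABEL: E–C typing (glue by name) over MODEL-side read-out arithmetic. WHAT THIS IS NOT: not NS — an implication whose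
hypothesis is one classical forced Navier–Stokes run nobody has exhibited; no slice of any flow is shown to be near the
layer; nothing asserted about `RungG 1` or blow-up. References: S. Palasek, arXiv:2605.13827 §4
[cite: Palasek2026ElementaryModel, §4]; J. M. Burgers, Adv. Appl. Mech. 1 (1948) 171–199.
-/

noncomputable section

-- `Summit.<Summit>.<Problem>` is the tree's mandated summit-side namespace (CONVENTIONS §2); for this
-- single-conjunct summit the two coincide, so the duplicate is deliberate.
set_option linter.dupNamespace false

namespace Summit.NavierStokesRegularity.NavierStokesRegularity.Theorems

open Set Function MeasureTheory
open scoped ENNReal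
open Summit.NavierStokesRegularity.NavierStokesRegularity.Theses
open Summit.NavierStokesRegularity.FluidComputer.PalasekTowerClayBridge
open Summit.NavierStokesRegularity.FluidComputer.PalasekTowerClayBridge.Germ
open Summit.NavierStokesRegularity.FluidComputer.PalasekTowerClayBridge.OrthogonalSeed
open Literature.Analysis.FluidPDE

variable {U : EuclideanSpace ℝ (Fin 3) → EuclideanSpace ℝ (Fin 3)} {ρ σ₀ ε c₄ : ℝ}

/-- **The three pointed level-`1` readouts of the explicit letter from CLOSENESS to a translated Burgers layer.**
For any continuous slice `w` and centre `c` with `‖c‖ + 1/120 ≤ ρ`: if `w` is within `261` of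
`OrthogonalSeed.readout` at `c + x⋆` (`x⋆ = (1/120, 0, 0)`), within `61000` (operator norm) in derivative at `c`
against `D readout(0)`, and within `500` along the loop `c + γ_{1/N₁}` (`γ = OrthogonalSeed.coreLoop`), then the
speed-floor, strain-floor and core-loop conjuncts of `ExplicitSliceRun` hold for `w` in `B̄(0, ρ)`.
[cite: Palasek2026ElementaryModel, §4] -/
theorem palasekTowerBreakdown_sliceReadouts_of_near_layer
    (w : EuclideanSpace ℝ (Fin 3) → EuclideanSpace ℝ (Fin 3)) (hw : Continuous w) {ρ : ℝ}
    (c : EuclideanSpace ℝ (Fin 3)) (hc : ‖c‖ + 1 / 120 ≤ ρ)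
    (h₁ : ‖w (c + !₂[(1 : ℝ) / 120, 0, 0]) - readout !₂[(1 : ℝ) / 120, 0, 0]‖ ≤ 261)
    (h₂ : ‖fderiv ℝ w c - fderiv ℝ readout 0‖ ≤ 61000)
    (h₃ : ∀ s ∈ Icc (0 : ℝ) 1, ‖w (c + coreLoop s) - readout (coreLoop s)‖ ≤ 500) :
    (∃ x, ‖x‖ ≤ ρ ∧ TowerRates.wide.Y 1 ≤ ‖w x‖) ∧
    (∃ x, ‖x‖ ≤ ρ ∧ TowerRates.wide.A 1 ≤ ‖fderiv ℝ w x‖) ∧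
    (∃ (x : EuclideanSpace ℝ (Fin 3)) (γ : ℝ → EuclideanSpace ℝ (Fin 3)),
      ‖x‖ ≤ ρ ∧ ContDiff ℝ 1 γ ∧ γ 0 = γ 1 ∧
      (∀ s ∈ Icc (0 : ℝ) 1, γ s ∈ Metric.closedBall x (1 / TowerRates.wide.N 1)) ∧
      (∀ s ∈ Icc (0 : ℝ) 1, ‖deriv γ s‖ ≤ 8 * Real.pi / TowerRates.wide.N 1) ∧
      TowerRates.wide.N 1 ^ (TowerRates.wide.β - 2) ≤ circulation w γ) := by
  have hc0 : ‖c‖ ≤ ρ := by linarith [show (0 : ℝ) ≤ 1 / 120 by norm_num]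
  refine ⟨⟨c + !₂[(1 : ℝ) / 120, 0, 0], ?_, speedFloor_of_near w c h₁⟩, ⟨c, hc0, strainFloor_of_near w c h₂⟩,
    ⟨c, fun s => c + coreLoop s, hc0, contDiff_const.add contDiff_coreLoop, by simp [coreLoop_closed],
      fun s _ => ?_, fun s _ => ?_, coreFloor_of_near hw c h₃⟩⟩
  · have hx : ‖(!₂[(1 : ℝ) / 120, 0, 0] : EuclideanSpace ℝ (Fin 3))‖ = 1 / 120 :=
      (sq_eq_sq₀ (norm_nonneg _) (by norm_num)).1 (by rw [norm_vec_sq]; ring)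
    exact (norm_add_le _ _).trans (by rw [hx]; exact hc)
  · rw [Metric.mem_closedBall, dist_eq_norm, add_sub_cancel_left, norm_coreLoop]
  · rw [deriv_const_add]; exact norm_deriv_coreLoop_le s

/-- **`EpisodeBase` FROM AN EXPLICIT DESIGN, ONE WINDOW RUN, AND CLOSENESS OF THE TERMINAL SLICE TO A BURGERS
LAYER.** An explicit germ design `d : LineGermData U ρ σ₀ ε c₄`; ONE classical finite-energy solution `(v, q)` of
Navier–Stokes at unit viscosity on `[1, Host.τfirst]` forced by the design's own faded residual `lineForce U σ₀ ε`,
starting from `v 1 = U`, below `(5/3) Y₁` throughout; and a centre `c` with `‖c‖ + 1/120 ≤ ρ` at which the terminal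
slice `v Host.τfirst` is within `261` of the translated layer at `c + x⋆`, within `61000` in derivative, and within
`500` along the loop `c + γ_{1/N₁}` ⟹ `EpisodeBase` (through `palasekTowerBreakdown_episodeBase_of_lineGerm_sliceRun`).
[cite: Palasek2026ElementaryModel, §4] -/
theorem palasekTowerBreakdown_episodeBase_of_lineGerm_run_near_layer (d : LineGermData U ρ σ₀ ε c₄)
    {v : ℝ → EuclideanSpace ℝ (Fin 3) → EuclideanSpace ℝ (Fin 3)} {q : ℝ → EuclideanSpace ℝ (Fin 3) → ℝ}
    (hcl : IsClassicalNSSolutionOn (Icc 1 Host.τfirst) 1 (lineForce U σ₀ ε) v q) (h1 : v 1 = U)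
    (henergy : ∃ C : ℝ≥0∞, C < ⊤ ∧ ∀ t ∈ Icc (1 : ℝ) Host.τfirst, ∫⁻ x, ‖v t x‖ₑ ^ 2 ≤ C)
    (hceil : ∀ t ∈ Icc (1 : ℝ) Host.τfirst, ∀ x, ‖v t x‖ ≤ 5 / 3 * TowerRates.wide.Y 1)
    (c : EuclideanSpace ℝ (Fin 3)) (hc : ‖c‖ + 1 / 120 ≤ ρ)
    (h₁ : ‖v Host.τfirst (c + !₂[(1 : ℝ) / 120, 0, 0]) - readout !₂[(1 : ℝ) / 120, 0, 0]‖ ≤ 261)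
    (h₂ : ‖fderiv ℝ (v Host.τfirst) c - fderiv ℝ readout 0‖ ≤ 61000)
    (h₃ : ∀ s ∈ Icc (0 : ℝ) 1, ‖v Host.τfirst (c + coreLoop s) - readout (coreLoop s)‖ ≤ 500) :
    PalasekTowerBreakdown.EpisodeBase := by
  have hτ : Host.τfirst ∈ Icc (1 : ℝ) Host.τfirst :=
    ⟨by rw [Host.τfirst_eq]; linarith [Host.wfirst_pos], le_rfl⟩
  have hw : Continuous (v Host.τfirst) := (hcl.contDiff_velocity hτ).continuous
  obtain ⟨hfloor, hstrain, hcore⟩ :=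
    palasekTowerBreakdown_sliceReadouts_of_near_layer (v Host.τfirst) hw c hc h₁ h₂ h₃
  exact palasekTowerBreakdown_episodeBase_of_lineGerm_sliceRun d hcl h1 henergy hceil hfloor hstrain hcore

end Summit.NavierStokesRegularity.NavierStokesRegularity.Theorems

end
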